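import Summits.QuantumFields.YangMills.Theorems.UnitScaleTiltHalvingOmegaRowMember
import HarnessLib

/-!
# Line H (`BirthV10.stub_halvingStep`, stmt-QuantumFields-19200) — (B-al-4)₃'s ω-ROW (F-ω), FILE 3-S (σ-EDITION of ✓FILE 3, LEAD-H ★w5-19200 g7 WORD 24): the POINTWISE oscillation bound reading the chart letter `c′` itself, and the
# σ-GUARDED member corollary `omegaRow_of_guards_σ` (row `hOsc` with ONE extra tail antecedent `c′ ≤ cσ`, `cσ` an OUTER real; closed form `ω_j^σ` = ✓FILE 3's with `c′max ↦ cσ`)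

Cell `ym3-torus` (HUMAN RULING D-0037: YM₃ on T³ is ladder rung R3 — NOT d = 4, NOT infinite volume, NOT a mass gap, NOT the Clay problem), width seat `ym3-torus-px9` gen 6.
`--supports stmt-QuantumFields-19200 --as helper`; THEOREMS ONLY (0 `def`, 0 `sorry`); count-neutral; nothing here claims (B-al-4)₃, the (b)-row, (M2′), the stub, the crux or the gap.

WHY (the θ-BUDGET SEAM, ym3-torus-px20 g5 05:58Z, memo `LOCATE-THETA-BUDGET-px20g5.md` = item evidence #47): ✓FILE 3 `HalvingOmegaRowMember.omegaRow_of_guards` majorises the chart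
letter `c′` by the row's own window `c′max = (8·3800((d+2)L)²)⁻¹`, an L-ONLY number, so its `ω_{k−1} ≥ 128d·c′max∕L` does not shrink with `ε₀` and the shell's budget `3θG ≤ θb = O(s′)`
cannot close. Print instantiates the chart on `□_k` at `c′ = 2L·c⋆ = O(s′)` ([Balaban1985RegularSpaces] (1.42) at `k − 1`); the cure is ONE more tail antecedent `c′ ≤ cσ` with `cσ`
quantified OUTSIDE the row (like `ω`), and the closed form read at `cσ`.  THIS FILE: §1 ★ `omegaRow_pointwise` — every antecedent of the row as a named hypothesis and the bound with
`c′` LITERAL (`x_j(c′) + 2a_j(c′) + a_j(c′)² + (2a_j + a_j²)x_j`, `x_j(c′) = d(L−1)(256(d+1)(d+4)(2ε₀)(Lʲ∕Lᵏ)² + Lʲη·c′)`, `a_j(c′) = 64d·Lʲη·c′`, `η = L^{−k}`, `k = K − n`; proof =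
✓FILE 3's, stopped before the majorisation); §2 ★★★ `omegaRow_of_guards_σ` — outer `(cσ : ℝ)`, the skeleton's `hOsc` antecedents VERBATIM with `c' ≤ cσ →` inserted right after
`8·3800·((d+2)L)²·c' ≤ 1 →`, conclusion `≤ ω_j^σ` := the same closed form at `cσ` (by §1 and ✓`omegaForm_mono`); at a consumer's `cσ := 2·(F.P K).L·cstar` the new antecedent
β-reduces to `c' ≤ 2·(F.P K).L·cstar`.  HONEST SCOPE: by-name plumbing over ✓FILES 1–3; the numeric window `0 ≤ ω_j^σ ≤ 1∕600` (needs `cσ` small) is a separate file.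

References: T. Bałaban, CMP **98** (1985) 17–51 [Balaban1985Averaging] ((11) p.19, (47) p.25, Prop. 2 (52)–(54) p.26, (84) p.30, (85) p.31, (99) p.32, (163) p.42);
CMP **99** (1985) 75–102 [Balaban1985RegularSpaces] ((1.15) p.78, (1.19) p.79, (1.29) p.81, (1.42) p.83, (1.69) p.88, p.98).
-/

set_option autoImplicit false

noncomputable section

open scoped BigOperators Matrix.Norms.L2Operator
open NormedSpace
open Complex (I)

namespace Summit.QuantumFields.YangMills.Theorems.HalvingOmegaRowMemberS

open Literature.MathematicalPhysics.QuantumFieldTheory.Balaban1983to89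
open Literature.MathematicalPhysics.QuantumFieldTheory.Balaban1983to89.T3ContinuumYM3Torus
open B7Prop1Explicit renaming Site → LSite
open B7Prop1Explicit (e e_apply boxVec axialFn gaugeAct hol treeWord U1 expUnit val_expUnit)
open B7Prop1Local (InBox AgreeOn loK bondHiK avgIter_congr hol_treeWord_congr)
open B7Prop2Explicit (avgIter pdev C0 c2' AvgClosed)
open B7Prop2SpecialUnitary (specialUnitaryUnits mem_specialUnitaryUnits specialUnitaryUnits_le_U1)
open B7Prop3Flat (expCfg c3)
open B7Eq92Concrete (mgauge mgauge_one_left)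
open B7Eq84Concrete (uavg)
open B7Eq99Concrete (wrec)
open B8Ineq130 (tlo thi tlo_apply thi_apply)
open B8Ineq132 (InAk Under under_tower)
open B8Eq119TwistedAxial (InAx Restr129)
open B8Eq131Cubes (cube sqLo sqHi tLo tHi)
open B8Eq131Derivation (under_one_block under_one_corner under_succ_of_under_block)
open B8Eq184Proof (cfgExp)
open B8CubeMemberZd (cubeLamS)
open B8Lemma1NonAbelian (lowPart boxVec_nonneg)
open B10Eq27TorusAxialLog (pull unitsField toUField)
open Summit.QuantumFields.YangMills.Theorems.Prop7AxialReprPrint (pull_toUField_mem pdev_pull_lt)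
open HalvingCombTorusTower (hblk_of_inAx avgClosed_su2)
open HalvingOmegaRow (norm_inv_mul_sample_sub_one_le)
open HalvingOmegaRowWrec (uavg_flat_eq_local norm_wrec_flat_sub_one_le norm_inv_uavg_mul_uavg_sub_one_le)
open HalvingOmegaRowMember (under_comp under_of_fine_bond under_of_depBox under_one_of_inBox inBox_tower_of_under gaugeAct_of_mgauge_one mem_su2_of_gaugeAct
  norm_cfgExp_sub_one_le eta_norm_le_of_chart omegaForm_mono)

variable (F : T3Family) {n K : ℕ}

/-! ## §1 ★ The pointwise bound, chart letter `c′` literal -/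

set_option maxHeartbeats 400000 in
/-- ★ **(F-ω) POINTWISE, READING `c′`**: under the door's guards as named hypotheses (anisotropy `InAk` at `ε₀`, axial gauge of every average, `u₁` `SU(2)`-valued, (R1) `u₁•W = U′`,
the chart `W = e^{iηA}` on `□_k` with `η‖A‖ ≤ c₁`, `e^{c₁} − 1 ≤ ηc′`, `0 ≤ c′`, `8·3800((d+2)L)²c′ ≤ 1`) and the outer windows, for `j < k = K − n`, a label `c` of the level-`(j+1)`
box and `r ∈ [0,L)ᵈ`: `‖R̄ʲu₁(Lc)⁻¹·R̄ʲu₁(Lc + r) − 1‖ ≤ x_j + 2a_j + a_j² + (2a_j + a_j²)x_j` with `x_j = d(L−1)(256(d+1)(d+4)(2ε₀)(Lʲ∕Lᵏ)² + Lʲη·c′)`, `a_j = 64d·Lʲη·c′`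
(✓FILE 1 on the true `W`; ✓FILE 2's (99)+(163) on the cut-off chart field at tower height `j`; (84) at the two points, locally). [cite: Balaban1985Averaging, (11) p.19, (47) p.25,
Prop. 2 (54) p.26, (84) p.30, (85) p.31, (99) p.32, (163) p.42; Balaban1985RegularSpaces, (1.15) p.78, (1.19) p.79, (1.29) p.81, p.98] -/
theorem omegaRow_pointwise {ε₀ : ℝ} (hε₀ : 0 < ε₀)
    (hα3 : C0 (F.P K).d * (2 * ε₀) ≤ 1 / 3) (hα2 : 2 * (2 * ε₀) ≤ c2' (F.P K).d (F.P K).L)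
    {αω : ℝ} (hαω : 0 < αω) (hαω3 : C0 (F.P K).d * αω ≤ 1 / 3) (hαω4 : 4 * αω ≤ c2' (F.P K).d (F.P K).L)
    (hαωexp : Real.exp (4 * (800 * (((F.P K).d : ℝ) + 1) ^ 2 * (((F.P K).d : ℝ) + 4)) * αω) ≤ 11 / 10)
    (a : LSite (F.P K).d) (M' ρ' : ℕ) (U : GaugeField (F.P K) 0 (Matrix.specialUnitaryGroup (Fin 2) ℂ))
    (gJ : GaugeTransf (F.P K) 0 (Matrix.specialUnitaryGroup (Fin 2) ℂ)) (u₁ : LSite (F.P K).d → (Matrix (Fin 2) (Fin 2) ℂ)ˣ)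
    (W : LSite (F.P K).d → Fin (F.P K).d → (Matrix (Fin 2) (Fin 2) ℂ)ˣ) (A : LSite (F.P K).d → Fin (F.P K).d → Matrix (Fin 2) (Fin 2) ℂ) (c₁ c' : ℝ)
    (hInAk : InAk (F.P K).L (K - n) (((F.L : ℝ)⁻¹) ^ (K - n)) ε₀ (fun _ => (Set.univ : Set (LSite (F.P K).d))) (pull (unitsField (toUField (GaugeField.gaugeAct gJ U))) 0))
    (hInAx : ∀ m', m' ≤ K - n → ∀ Λ : ℕ → Set (LSite (F.P K).d),
      InAx (F.P K).L m' Λ (1 : LSite (F.P K).d → Fin (F.P K).d → (Matrix (Fin 2) (Fin 2) ℂ)ˣ) (pull (unitsField (toUField (GaugeField.gaugeAct gJ U))) 0))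
    (hu₁ : ∀ z, ((u₁ z : (Matrix (Fin 2) (Fin 2) ℂ)ˣ) : Matrix (Fin 2) (Fin 2) ℂ) ∈ Matrix.specialUnitaryGroup (Fin 2) ℂ)
    (hR1m : mgauge (1 : LSite (F.P K).d → Fin (F.P K).d → (Matrix (Fin 2) (Fin 2) ℂ)ˣ) u₁ W = pull (unitsField (toUField (GaugeField.gaugeAct gJ U))) 0)
    (hc' : 0 ≤ c') (h3800 : 8 * 3800 * ((((F.P K).d + 2) * (F.P K).L : ℕ) : ℝ) ^ 2 * c' ≤ 1) (hexp : Real.exp c₁ - 1 ≤ ((F.L : ℝ)⁻¹) ^ (K - n) * c')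
    (hcube : ∀ z ∈ cube (F.P K).L a M' ρ' (K - n) (K - n), ∀ ν : Fin (F.P K).d,
      W z ν = cfgExp (((F.L : ℝ)⁻¹) ^ (K - n)) A z ν ∧ ((F.L : ℝ)⁻¹) ^ (K - n) * ‖A z ν‖ ≤ c₁)
    {j : ℕ} (hj : j < K - n) (c : LSite (F.P K).d)
    (hc : InBox (tlo (F.P K).L (sqLo (F.P K).L a ρ' (K - n) (K - n)) (K - n - (j + 1))) (thi (F.P K).L (sqHi (F.P K).L a M' ρ' (K - n) (K - n)) (K - n - (j + 1))) c)
    (r : Fin (F.P K).d → Fin (F.P K).L) :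
    ‖((((uavg (F.P K).L (1 : LSite (F.P K).d → Fin (F.P K).d → (Matrix (Fin 2) (Fin 2) ℂ)ˣ) u₁ j (((F.P K).L : ℤ) • c))⁻¹ *
        uavg (F.P K).L (1 : LSite (F.P K).d → Fin (F.P K).d → (Matrix (Fin 2) (Fin 2) ℂ)ˣ) u₁ j (((F.P K).L : ℤ) • c + boxVec (F.P K).L r)) :
      (Matrix (Fin 2) (Fin 2) ℂ)ˣ) : Matrix (Fin 2) (Fin 2) ℂ) - 1‖ ≤
            (((F.P K).d : ℝ) * (((F.P K).L : ℝ) - 1)) * (256 * (((F.P K).d : ℝ) + 1) * (((F.P K).d : ℝ) + 4) * (2 * ε₀) * (((F.P K).L : ℝ) ^ j * (((F.P K).L : ℝ) ^ (K - n))⁻¹) ^ 2 +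
                ((F.P K).L : ℝ) ^ j * (((F.L : ℝ)⁻¹) ^ (K - n) * c'))
              + 2 * (64 * ((F.P K).d : ℝ) * (((F.P K).L : ℝ) ^ j * (((F.L : ℝ)⁻¹) ^ (K - n) * c')))
              + (64 * ((F.P K).d : ℝ) * (((F.P K).L : ℝ) ^ j * (((F.L : ℝ)⁻¹) ^ (K - n) * c'))) ^ 2
              + (2 * (64 * ((F.P K).d : ℝ) * (((F.P K).L : ℝ) ^ j * (((F.L : ℝ)⁻¹) ^ (K - n) * c'))) +
                  (64 * ((F.P K).d : ℝ) * (((F.P K).L : ℝ) ^ j * (((F.L : ℝ)⁻¹) ^ (K - n) * c'))) ^ 2) *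
                ((((F.P K).d : ℝ) * (((F.P K).L : ℝ) - 1)) * (256 * (((F.P K).d : ℝ) + 1) * (((F.P K).d : ℝ) + 4) * (2 * ε₀) * (((F.P K).L : ℝ) ^ j * (((F.P K).L : ℝ) ^ (K - n))⁻¹) ^ 2 +
                  ((F.P K).L : ℝ) ^ j * (((F.L : ℝ)⁻¹) ^ (K - n) * c'))) := by
  classical
  -- letters
  set k : ℕ := K - n with hk
  set η : ℝ := ((F.L : ℝ)⁻¹) ^ (K - n) with hη
  set U' : LSite (F.P K).d → Fin (F.P K).d → (Matrix (Fin 2) (Fin 2) ℂ)ˣ := pull (unitsField (toUField (GaugeField.gaugeAct gJ U))) 0 with hU'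
  have hFL : ((F.P K).L : ℝ) = (F.L : ℝ) := rfl
  have hL2 : 2 ≤ (F.P K).L := (F.P K).hL.2; have hL1 : 1 ≤ (F.P K).L := le_trans (by norm_num) hL2
  have hL3 : 3 ≤ (F.P K).L := by have hodd : Odd (F.P K).L := F.hL.1; obtain ⟨t, ht⟩ := hodd; omega
  have hLr3 : (3 : ℝ) ≤ ((F.P K).L : ℝ) := by exact_mod_cast hL3
  have hLr0 : (0 : ℝ) < ((F.P K).L : ℝ) := by linarith
  have hdr : ((F.P K).d : ℝ) = 3 := by rw [T3Family.P_d F K]; norm_num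
  have hη0 : 0 ≤ η := by rw [hη]; positivity
  have hηc : 0 ≤ η * c' := mul_nonneg hη0 hc'
  -- (R1), the groups, the guards
  have hR1 : gaugeAct u₁ W = U' := gaugeAct_of_mgauge_one hR1m; have hU'G := fun x κ => pull_toUField_mem (GaugeField.gaugeAct gJ U) 0 x κ
  have hWG : ∀ x κ, W x κ ∈ specialUnitaryUnits (Fin 2) := mem_su2_of_gaugeAct hR1 hu₁ hU'G
  have hG : AvgClosed (F.P K).d (F.P K).L (specialUnitaryUnits (Fin 2)) := avgClosed_su2 (F.P K).d (F.P K).L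
  have huU1 : ∀ x, u₁ x ∈ U1 (Matrix (Fin 2) (Fin 2) ℂ) := fun x => specialUnitaryUnits_le_U1 (mem_specialUnitaryUnits.2 (hu₁ x))
  have h52 : pdev U' < 2 * ε₀ * ((((F.P K).L : ℝ) ^ k)⁻¹) ^ 2 := pdev_pull_lt hε₀ hInAk 0
  have hblk := hblk_of_inAx U' hInAx
  -- the chart on the fine cube
  have hchart : ∀ y ∈ cube (F.P K).L a M' ρ' k k, ∀ μ : Fin (F.P K).d, ‖((W y μ : (Matrix (Fin 2) (Fin 2) ℂ)ˣ) : Matrix (Fin 2) (Fin 2) ℂ) - 1‖ ≤ η * c' := by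
    intro y hy μ; obtain ⟨hW, hA⟩ := hcube y hy μ; rw [hW]; exact norm_cfgExp_sub_one_le hη0 A y μ hA hexp
  have hcubeOf : ∀ p : LSite (F.P K).d, Under (F.P K).L (j + 1) c p → p ∈ cube (F.P K).L a M' ρ' k k := by
    intro p hp; have h := inBox_tower_of_under hc hp; rwa [show k - (j + 1) + (j + 1) = k by omega] at h
  -- (x) FILE 1 on the true `W` at level `j`, block `c`
  have hax : ∀ r' : Fin (F.P K).d → Fin (F.P K).L,
      axialFn (avgIter (F.P K).L U' j) (((F.P K).L : ℤ) • c) (((F.P K).L : ℤ) • c + boxVec (F.P K).L r') = 1 := by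
    intro r'; have h := hblk (k - 1 - j) (by omega) c r'; rwa [show k - (k - 1 - j + 1) = j by omega] at h
  have hw : ∀ (y : LSite (F.P K).d) (μ : Fin (F.P K).d), (((F.P K).L : ℤ) ^ (j + 1)) • c ≤ y →
      y + e μ ≤ (((F.P K).L : ℤ) ^ (j + 1)) • c + (fun _ => ((F.P K).L : ℤ) ^ (j + 1) - 1) →
      ‖((W y μ : (Matrix (Fin 2) (Fin 2) ℂ)ˣ) : Matrix (Fin 2) (Fin 2) ℂ) - 1‖ ≤ η * c' :=
    fun y μ hy hyμ => hchart y (hcubeOf y (under_of_fine_bond (j + 1) c y μ hy hyμ)) μ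
  have hX := norm_inv_mul_sample_sub_one_le (F.P K).L hL2 hG k U' W hWG u₁ huU1 hR1 (α₀ := 2 * ε₀) (by positivity) hα3 hα2 h52
    hj.le c hax hηc hw r
  -- (a) FILE 2 §2 on the cut-off chart field `W̃ = e^{B̃}`, tower height `j`
  set Bt : LSite (F.P K).d → Fin (F.P K).d → Matrix (Fin 2) (Fin 2) ℂ :=
    fun x μ => if x ∈ cube (F.P K).L a M' ρ' k k then I • (η • A x μ) else 0 with hBt
  have hBtb : ∀ x μ, ‖Bt x μ‖ ≤ η * c' := by
    intro x μ; simp only [hBt]; split_ifs with hx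
    · rw [norm_smul, Complex.norm_I, one_mul, norm_smul, Real.norm_eq_abs, abs_of_nonneg hη0]; exact eta_norm_le_of_chart A x μ (hcube x hx μ).2 hexp
    · rw [norm_zero]; exact hηc
  -- the windows of (163) at tower height `j`: `Lʲ·ηc′ ≤ c′∕L`
  have hc'1 : c' ≤ 1 / (8 * 3800 * ((((F.P K).d + 2) * (F.P K).L : ℕ) : ℝ) ^ 2) := by
    have hpos : (0 : ℝ) < 8 * 3800 * ((((F.P K).d + 2) * (F.P K).L : ℕ) : ℝ) ^ 2 := by
      have : (1 : ℝ) ≤ ((((F.P K).d + 2) * (F.P K).L : ℕ) : ℝ) := by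
        have h1 : 1 ≤ ((F.P K).d + 2) * (F.P K).L := Nat.one_le_iff_ne_zero.mpr (by positivity)
        exact_mod_cast h1
      positivity
    rw [le_div_iff₀ hpos]; linarith
  have hcast : ((((F.P K).d + 2) * (F.P K).L : ℕ) : ℝ) = 5 * ((F.P K).L : ℝ) := by push_cast; rw [hdr]; ring
  have hc'L2 : c' * ((F.P K).L : ℝ) ^ 2 ≤ 1 / 760000 := by
    rw [hcast] at hc'1
    have hpos : (0 : ℝ) < 8 * 3800 * (5 * ((F.P K).L : ℝ)) ^ 2 := by positivity
    have h := (le_div_iff₀ hpos).1 hc'1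
    have e : c' * (8 * 3800 * (5 * ((F.P K).L : ℝ)) ^ 2) = 760000 * (c' * ((F.P K).L : ℝ) ^ 2) := by ring
    rw [e] at h
    rw [le_div_iff₀ (by norm_num : (0 : ℝ) < 760000)]
    linarith
  have hLjη : ((F.P K).L : ℝ) ^ j * η * (F.P K).L ≤ 1 := by
    rw [hη, ← hFL, inv_pow]
    have hjk : j + 1 ≤ k := hj
    have h1 : ((F.P K).L : ℝ) ^ j * (F.P K).L = ((F.P K).L : ℝ) ^ (j + 1) := by ring
    have h2 : ((F.P K).L : ℝ) ^ (j + 1) ≤ ((F.P K).L : ℝ) ^ k := pow_le_pow_right₀ (by linarith) hjk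
    have h3 : 0 < ((F.P K).L : ℝ) ^ k := by positivity
    calc ((F.P K).L : ℝ) ^ j * (((F.P K).L : ℝ) ^ (K - n))⁻¹ * (F.P K).L = ((F.P K).L : ℝ) ^ (j + 1) * (((F.P K).L : ℝ) ^ k)⁻¹ := by rw [hk]; ring
      _ ≤ ((F.P K).L : ℝ) ^ k * (((F.P K).L : ℝ) ^ k)⁻¹ := mul_le_mul_of_nonneg_right h2 (by positivity)
      _ = 1 := mul_inv_cancel₀ h3.ne'
  -- `t := Lʲ·b = Lʲηc′ ≤ c′∕L ≤ 1∕(760000·L³)`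
  obtain ⟨t, ht⟩ : ∃ t : ℝ, t = ((F.P K).L : ℝ) ^ j * (η * c') := ⟨_, rfl⟩
  have ht0 : 0 ≤ t := by rw [ht]; positivity
  have htL3 : t * ((F.P K).L : ℝ) ^ 3 ≤ 1 / 760000 := by
    have h1 : t * ((F.P K).L : ℝ) ^ 3 = (((F.P K).L : ℝ) ^ j * η * (F.P K).L) * (c' * ((F.P K).L : ℝ) ^ 2) := by rw [ht]; ring
    rw [h1]
    have h2 : 0 ≤ c' * ((F.P K).L : ℝ) ^ 2 := by positivity
    calc _ ≤ 1 * (c' * ((F.P K).L : ℝ) ^ 2) := mul_le_mul_of_nonneg_right hLjη h2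
      _ ≤ 1 / 760000 := by rw [one_mul]; exact hc'L2
  have h27 : (27 : ℝ) ≤ ((F.P K).L : ℝ) ^ 3 := by have h := pow_le_pow_left₀ (by norm_num : (0 : ℝ) ≤ 3) hLr3 3; norm_num at h; exact h
  have ht27 : t ≤ 1 / (760000 * 27) := by
    have : t * 27 ≤ 1 / 760000 := (mul_le_mul_of_nonneg_left h27 ht0).trans htL3; rw [le_div_iff₀ (by norm_num)]; linarith
  have htL : t * ((F.P K).L : ℝ) ≤ 1 / (760000 * 9) := by
    have h9 : (9 : ℝ) ≤ ((F.P K).L : ℝ) ^ 2 := by nlinarith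
    have h1 : t * ((F.P K).L : ℝ) * 9 ≤ t * ((F.P K).L : ℝ) ^ 3 := by
      have e : t * ((F.P K).L : ℝ) ^ 3 = t * ((F.P K).L : ℝ) * ((F.P K).L : ℝ) ^ 2 := by ring
      rw [e]
      exact mul_le_mul_of_nonneg_left h9 (by positivity)
    rw [le_div_iff₀ (by norm_num)]; linarith
  have hsmallω : Real.exp (4 * (800 * (((F.P K).d : ℝ) + 1) ^ 2 * (((F.P K).d : ℝ) + 4)) * αω) *
      (1 + 8 * (131072 * (((F.P K).d : ℝ) + 1) ^ 2) * (((F.P K).L : ℝ) ^ j * (η * c'))) ≤ 2 := by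
    rw [← ht]
    have h1 : 1 + 8 * (131072 * (((F.P K).d : ℝ) + 1) ^ 2) * t ≤ 18177 / 10000 := by
      rw [hdr]
      have e : 8 * (131072 * ((3 : ℝ) + 1) ^ 2) * t = 16777216 * t := by ring
      rw [e]
      linarith
    have h0 : 0 ≤ 1 + 8 * (131072 * (((F.P K).d : ℝ) + 1) ^ 2) * t := by positivity
    calc _ ≤ (11 / 10) * (18177 / 10000) := mul_le_mul hαωexp h1 h0 (by norm_num)
      _ ≤ 2 := by norm_num
  have hc3ω : 2 * (((F.P K).L : ℝ) ^ j * (η * c')) ≤ c3 (F.P K).d (F.P K).L := by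
    rw [← ht, B7Prop3Flat.c3, hdr]
    rw [le_div_iff₀ (by positivity)]
    have e : 2 * t * (128 * ((3 : ℝ) + 1) * ((F.P K).L : ℝ)) = 1024 * (t * ((F.P K).L : ℝ)) := by ring
    rw [e]
    linarith
  have hsmω : 2048 * ((F.P K).d : ℝ) * (((F.P K).L : ℝ) ^ j * (η * c')) ≤ 1 := by rw [← ht, hdr]; linarith
  have ha : ∀ y : LSite (F.P K).d,
      ‖((wrec (F.P K).L (1 : LSite (F.P K).d → Fin (F.P K).d → (Matrix (Fin 2) (Fin 2) ℂ)ˣ) (expCfg Bt) j y : (Matrix (Fin 2) (Fin 2) ℂ)ˣ) : Matrix (Fin 2) (Fin 2) ℂ) - 1‖ ≤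
          64 * ((F.P K).d : ℝ) * (((F.P K).L : ℝ) ^ j * (η * c')) ∧
        ‖(((wrec (F.P K).L (1 : LSite (F.P K).d → Fin (F.P K).d → (Matrix (Fin 2) (Fin 2) ℂ)ˣ) (expCfg Bt) j y)⁻¹ : (Matrix (Fin 2) (Fin 2) ℂ)ˣ) : Matrix (Fin 2) (Fin 2) ℂ) - 1‖ ≤
          64 * ((F.P K).d : ℝ) * (((F.P K).L : ℝ) ^ j * (η * c')) := fun y =>
    norm_wrec_flat_sub_one_le (F.P K).L hL2 hG j Bt hηc hBtb hαω hαω3 hαω4 hsmallω hc3ω hsmω le_rfl y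
  -- (84) at the two points, with `W̃`: block-axiality of `u₁•W̃` under them transferred from `U′ = u₁•W`
  have hWt : ∀ p ∈ cube (F.P K).L a M' ρ' k k, ∀ ν : Fin (F.P K).d, expCfg Bt p ν = W p ν := by
    intro p hp ν; rw [(hcube p hp ν).1]; show expUnit (Bt p ν) = cfgExp η A p ν; simp only [hBt, if_pos hp]; rfl
  have hloc : ∀ y : LSite (F.P K).d, Under (F.P K).L 1 c y → ∀ n', n' < j → ∀ z : LSite (F.P K).d, Under (F.P K).L (j - (n' + 1)) y z →
      ∀ r' : Fin (F.P K).d → Fin (F.P K).L,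
        axialFn (avgIter (F.P K).L (gaugeAct u₁ (expCfg Bt)) n') (((F.P K).L : ℤ) • z) (((F.P K).L : ℤ) • z + boxVec (F.P K).L r') = 1 := by
    intro y hy n' hn' z hz r'
    have hzc : Under (F.P K).L (j - n') c z := by
      have h := under_succ_of_under_block hy hz; rwa [show j - (n' + 1) + 1 = j - n' by omega] at h
    have hagree : AgreeOn (((F.P K).L : ℤ) • z) ((((F.P K).L : ℤ) • z) + fun _ => ((F.P K).L : ℤ) - 1)
        (avgIter (F.P K).L (gaugeAct u₁ (expCfg Bt)) n') (avgIter (F.P K).L U' n') := by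
      intro x μ hx hxμ
      refine avgIter_congr (F.P K).L hL1 n' x μ fun p ν hp _ => ?_
      have hpz : Under (F.P K).L (n' + 1) z p := under_of_depBox n' (under_one_of_inBox hx) (under_one_of_inBox hxμ) hp
      have hpc : Under (F.P K).L (j + 1) c p := by have h := under_comp hzc hpz; rwa [show j - n' + (n' + 1) = j + 1 by omega] at h
      rw [← hR1]; simp only [gaugeAct, hWt p (hcubeOf p hpc) ν]
    have hL2z : (2 : ℤ) ≤ (F.P K).L := by exact_mod_cast hL2
    have hLpos : (0 : ℤ) ≤ ((F.P K).L : ℤ) - 1 := by linarith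
    have hp0 : InBox (((F.P K).L : ℤ) • z) ((((F.P K).L : ℤ) • z) + fun _ => ((F.P K).L : ℤ) - 1) (((F.P K).L : ℤ) • z) := fun i => by
      simp only [Pi.add_apply]; constructor <;> linarith
    have hpv : InBox (((F.P K).L : ℤ) • z) ((((F.P K).L : ℤ) • z) + fun _ => ((F.P K).L : ℤ) - 1) (((F.P K).L : ℤ) • z + boxVec (F.P K).L r') := fun i => by
      simp only [Pi.add_apply, boxVec]
      have h1 := (r' i).isLt
      have h2 : (0 : ℤ) ≤ ((r' i : ℕ) : ℤ) := Int.natCast_nonneg _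
      have h3 : ((r' i : ℕ) : ℤ) ≤ ((F.P K).L : ℤ) - 1 := by omega
      constructor <;> linarith
    have hU : axialFn (avgIter (F.P K).L U' n') (((F.P K).L : ℤ) • z) (((F.P K).L : ℤ) • z + boxVec (F.P K).L r') = 1 := by
      have h := hblk (k - 1 - n') (by omega) z r'; rwa [show k - (k - 1 - n' + 1) = n' by omega] at h
    unfold axialFn at hU ⊢
    rw [add_sub_cancel_left] at hU ⊢; rw [hol_treeWord_congr hagree _ _ hp0 hpv]; exact hU
  have h84 : ∀ y : LSite (F.P K).d, Under (F.P K).L 1 c y →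
      uavg (F.P K).L (1 : LSite (F.P K).d → Fin (F.P K).d → (Matrix (Fin 2) (Fin 2) ℂ)ˣ) u₁ j y =
        u₁ ((((F.P K).L : ℤ) ^ j) • y) * wrec (F.P K).L (1 : LSite (F.P K).d → Fin (F.P K).d → (Matrix (Fin 2) (Fin 2) ℂ)ˣ) (expCfg Bt) j y :=
    fun y hy => uavg_flat_eq_local (F.P K).L hL1 (expCfg Bt) u₁ j y (hloc y hy)
  -- assemble
  have hmain := norm_inv_uavg_mul_uavg_sub_one_le (F.P K).L (expCfg Bt) u₁ j c r (h84 _ (under_one_corner hL1 c))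
    (h84 _ (under_one_block (F.P K).L c r)) hX (ha _).2 (ha _).1
  rw [hFL] at hmain ⊢; exact hmain

/-! ## §2 ★★★ The σ-guarded member corollary: the skeleton's row `hOsc` with the tail guard `c′ ≤ cσ` -/

set_option maxHeartbeats 400000 in
/-- ★★★ **(F-ω) AT THE MEMBER, σ-GUARDED** (row `hOsc` of the σ-edition of the core): OUTER `cσ : ℝ`; the ✓FILE 3 antecedents VERBATIM with ONE insertion `c' ≤ cσ →` after the
row's window `8·3800((d+2)L)²c' ≤ 1 →`; conclusion `≤ ω_j^σ := x_j(cσ) + 2a_j(cσ) + a_j(cσ)² + (2a_j(cσ) + a_j(cσ)²)·x_j(cσ)` — ✓FILE 3's closed form with `c′max ↦ cσ` (§1 at `c′`,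
then `c′ ≤ cσ` by ✓`omegaForm_mono`). At print's `cσ = 2L·c⋆ = O(s′)`: `a_j ≤ 64d·cσ∕L`, so `ω^σ = O(ε₀ + s′)` and the shell's `θG = O(s′²)`. [cite: Balaban1985Averaging, (84) p.30,
(99) p.32, (163) p.42; Balaban1985RegularSpaces, (1.29) p.81, (1.42) p.83, p.98] -/
theorem omegaRow_of_guards_σ {ε₀ : ℝ} (hε₀ : 0 < ε₀)
    (hα3 : C0 (F.P K).d * (2 * ε₀) ≤ 1 / 3) (hα2 : 2 * (2 * ε₀) ≤ c2' (F.P K).d (F.P K).L)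
    {αω : ℝ} (hαω : 0 < αω) (hαω3 : C0 (F.P K).d * αω ≤ 1 / 3) (hαω4 : 4 * αω ≤ c2' (F.P K).d (F.P K).L)
    (hαωexp : Real.exp (4 * (800 * (((F.P K).d : ℝ) + 1) ^ 2 * (((F.P K).d : ℝ) + 4)) * αω) ≤ 11 / 10)
    (a : LSite (F.P K).d) (M' ρ' : ℕ) (s cσ : ℝ) (U : GaugeField (F.P K) 0 (Matrix.specialUnitaryGroup (Fin 2) ℂ)) :
    ∀ (gJ : GaugeTransf (F.P K) 0 (Matrix.specialUnitaryGroup (Fin 2) ℂ)) (u₁ : LSite (F.P K).d → (Matrix (Fin 2) (Fin 2) ℂ)ˣ)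
        (W : LSite (F.P K).d → Fin (F.P K).d → (Matrix (Fin 2) (Fin 2) ℂ)ˣ) (A : LSite (F.P K).d → Fin (F.P K).d → Matrix (Fin 2) (Fin 2) ℂ) (c₁ c' : ℝ),
      InAk (F.P K).L (K - n) (((F.L : ℝ)⁻¹) ^ (K - n)) ε₀ (fun _ => (Set.univ : Set (LSite (F.P K).d))) (pull (unitsField (toUField (GaugeField.gaugeAct gJ U))) 0) →
      (∀ m', m' ≤ K - n → ∀ Λ : ℕ → Set (LSite (F.P K).d), InAx (F.P K).L m' Λ (1 : LSite (F.P K).d → Fin (F.P K).d → (Matrix (Fin 2) (Fin 2) ℂ)ˣ) (pull (unitsField (toUField (GaugeField.gaugeAct gJ U))) 0)) →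
      (∀ m', m' ≤ K - n → ∀ (x : LSite (F.P K).d) (ν : Fin (F.P K).d), tlo (F.P K).L (tLo a ρ') m' ≤ x → x + e ν ≤ thi (F.P K).L (tHi a M' ρ') m' →
        ‖((avgIter (F.P K).L (pull (unitsField (toUField (GaugeField.gaugeAct gJ U))) 0) (K - n - m') x ν : (Matrix (Fin 2) (Fin 2) ℂ)ˣ) : Matrix (Fin 2) (Fin 2) ℂ) - 1‖ < s) →
      (∀ (x : LSite (F.P K).d) (ν : Fin (F.P K).d), tLo a ρ' ≤ x → x + e ν ≤ tHi a M' ρ' → lowPart ν (x - tLo a ρ') = 0 →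
        avgIter (F.P K).L (pull (unitsField (toUField (GaugeField.gaugeAct gJ U))) 0) (K - n) x ν = 1) →
      (∀ z, ((u₁ z : (Matrix (Fin 2) (Fin 2) ℂ)ˣ) : Matrix (Fin 2) (Fin 2) ℂ) ∈ Matrix.specialUnitaryGroup (Fin 2) ℂ) →
      mgauge (1 : LSite (F.P K).d → Fin (F.P K).d → (Matrix (Fin 2) (Fin 2) ℂ)ˣ) u₁ W = pull (unitsField (toUField (GaugeField.gaugeAct gJ U))) 0 →
      0 ≤ c' → 8 * 3800 * ((((F.P K).d + 2) * (F.P K).L : ℕ) : ℝ) ^ 2 * c' ≤ 1 → c' ≤ cσ → Real.exp c₁ - 1 ≤ ((F.L : ℝ)⁻¹) ^ (K - n) * c' →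
      (∀ z ∈ cube (F.P K).L a M' ρ' (K - n) (K - n), ∀ ν : Fin (F.P K).d, W z ν = cfgExp (((F.L : ℝ)⁻¹) ^ (K - n)) A z ν ∧ ((F.L : ℝ)⁻¹) ^ (K - n) * ‖A z ν‖ ≤ c₁) →
      Restr129 (F.P K).L (K - n) (cubeLamS (F.P K).L a M' ρ' (K - n) (K - n)) (1 : LSite (F.P K).d → Fin (F.P K).d → (Matrix (Fin 2) (Fin 2) ℂ)ˣ) u₁ →
      ∀ j, j < K - n → ∀ c : LSite (F.P K).d,
        InBox (tlo (F.P K).L (sqLo (F.P K).L a ρ' (K - n) (K - n)) (K - n - (j + 1))) (thi (F.P K).L (sqHi (F.P K).L a M' ρ' (K - n) (K - n)) (K - n - (j + 1))) c →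
        ∀ r : Fin (F.P K).d → Fin (F.P K).L,
          ‖((((uavg (F.P K).L (1 : LSite (F.P K).d → Fin (F.P K).d → (Matrix (Fin 2) (Fin 2) ℂ)ˣ) u₁ j (((F.P K).L : ℤ) • c))⁻¹ *
              uavg (F.P K).L (1 : LSite (F.P K).d → Fin (F.P K).d → (Matrix (Fin 2) (Fin 2) ℂ)ˣ) u₁ j (((F.P K).L : ℤ) • c + boxVec (F.P K).L r)) :
            (Matrix (Fin 2) (Fin 2) ℂ)ˣ) : Matrix (Fin 2) (Fin 2) ℂ) - 1‖ ≤
            (((F.P K).d : ℝ) * (((F.P K).L : ℝ) - 1)) * (256 * (((F.P K).d : ℝ) + 1) * (((F.P K).d : ℝ) + 4) * (2 * ε₀) * (((F.P K).L : ℝ) ^ j * (((F.P K).L : ℝ) ^ (K - n))⁻¹) ^ 2 +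
                ((F.P K).L : ℝ) ^ j * (((F.L : ℝ)⁻¹) ^ (K - n) * cσ))
              + 2 * (64 * ((F.P K).d : ℝ) * (((F.P K).L : ℝ) ^ j * (((F.L : ℝ)⁻¹) ^ (K - n) * cσ)))
              + (64 * ((F.P K).d : ℝ) * (((F.P K).L : ℝ) ^ j * (((F.L : ℝ)⁻¹) ^ (K - n) * cσ))) ^ 2
              + (2 * (64 * ((F.P K).d : ℝ) * (((F.P K).L : ℝ) ^ j * (((F.L : ℝ)⁻¹) ^ (K - n) * cσ))) +
                  (64 * ((F.P K).d : ℝ) * (((F.P K).L : ℝ) ^ j * (((F.L : ℝ)⁻¹) ^ (K - n) * cσ))) ^ 2) *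
                ((((F.P K).d : ℝ) * (((F.P K).L : ℝ) - 1)) * (256 * (((F.P K).d : ℝ) + 1) * (((F.P K).d : ℝ) + 4) * (2 * ε₀) * (((F.P K).L : ℝ) ^ j * (((F.P K).L : ℝ) ^ (K - n))⁻¹) ^ 2 +
                  ((F.P K).L : ℝ) ^ j * (((F.L : ℝ)⁻¹) ^ (K - n) * cσ))) := by
  intro gJ u₁ W A c₁ c' hInAk hInAx _ _ hu₁ hR1m hc' h3800 hcσ hexp hcube _ j hj c hc r
  have hmain := omegaRow_pointwise F hε₀ hα3 hα2 hαω hαω3 hαω4 hαωexp a M' ρ' U gJ u₁ W A c₁ c' hInAk hInAx hu₁ hR1m hc' h3800 hexp hcube hj c hc r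
  have hFL : ((F.P K).L : ℝ) = (F.L : ℝ) := rfl
  have hL2 : 2 ≤ (F.P K).L := (F.P K).hL.2
  have hLr2 : (2 : ℝ) ≤ ((F.P K).L : ℝ) := by exact_mod_cast hL2
  have hη0 : 0 ≤ ((F.L : ℝ)⁻¹) ^ (K - n) := by positivity
  have hD0 : 0 ≤ ((F.P K).d : ℝ) * (((F.P K).L : ℝ) - 1) := mul_nonneg (Nat.cast_nonneg _) (by linarith)
  have htle : ((F.P K).L : ℝ) ^ j * (((F.L : ℝ)⁻¹) ^ (K - n) * c') ≤ ((F.P K).L : ℝ) ^ j * (((F.L : ℝ)⁻¹) ^ (K - n) * cσ) :=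
    mul_le_mul_of_nonneg_left (mul_le_mul_of_nonneg_left hcσ hη0) (by positivity)
  have hx0 : 0 ≤ (((F.P K).d : ℝ) * (((F.P K).L : ℝ) - 1)) *
      (256 * (((F.P K).d : ℝ) + 1) * (((F.P K).d : ℝ) + 4) * (2 * ε₀) * (((F.P K).L : ℝ) ^ j * (((F.P K).L : ℝ) ^ (K - n))⁻¹) ^ 2 +
        ((F.P K).L : ℝ) ^ j * (((F.L : ℝ)⁻¹) ^ (K - n) * c')) :=
    mul_nonneg hD0 (add_nonneg (by positivity) (mul_nonneg (by positivity) (mul_nonneg hη0 hc')))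
  have hxle : (((F.P K).d : ℝ) * (((F.P K).L : ℝ) - 1)) *
      (256 * (((F.P K).d : ℝ) + 1) * (((F.P K).d : ℝ) + 4) * (2 * ε₀) * (((F.P K).L : ℝ) ^ j * (((F.P K).L : ℝ) ^ (K - n))⁻¹) ^ 2 +
        ((F.P K).L : ℝ) ^ j * (((F.L : ℝ)⁻¹) ^ (K - n) * c')) ≤
      (((F.P K).d : ℝ) * (((F.P K).L : ℝ) - 1)) *
      (256 * (((F.P K).d : ℝ) + 1) * (((F.P K).d : ℝ) + 4) * (2 * ε₀) * (((F.P K).L : ℝ) ^ j * (((F.P K).L : ℝ) ^ (K - n))⁻¹) ^ 2 +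
        ((F.P K).L : ℝ) ^ j * (((F.L : ℝ)⁻¹) ^ (K - n) * cσ)) :=
    mul_le_mul_of_nonneg_left (add_le_add le_rfl htle) hD0
  have ha0 : 0 ≤ 64 * ((F.P K).d : ℝ) * (((F.P K).L : ℝ) ^ j * (((F.L : ℝ)⁻¹) ^ (K - n) * c')) :=
    mul_nonneg (by positivity) (mul_nonneg (by positivity) (mul_nonneg hη0 hc'))
  have hale : 64 * ((F.P K).d : ℝ) * (((F.P K).L : ℝ) ^ j * (((F.L : ℝ)⁻¹) ^ (K - n) * c')) ≤
      64 * ((F.P K).d : ℝ) * (((F.P K).L : ℝ) ^ j * (((F.L : ℝ)⁻¹) ^ (K - n) * cσ)) :=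
    mul_le_mul_of_nonneg_left htle (by positivity)
  have hfin := hmain.trans (omegaForm_mono hx0 ha0 hxle hale)
  rw [hFL] at hfin ⊢; exact hfin

end Summit.QuantumFields.YangMills.Theorems.HalvingOmegaRowMemberS

end
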